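import Literature.AlgebraicGeometry.Motives.CartierDivisorIntersectionCycle
import Literature.AlgebraicGeometry.Motives.CyclesRatTrivialOn
import HarnessLib

/-!
# `D · α` modulo rational equivalence on its support (Fulton, Def. 2.3, Prop. 2.3 (b), (e))

The cycle `D · α` of `Motives/CartierDivisorIntersectionCycle` (Fulton, *Intersection Theory*,
Def. 2.3) is a *representative* of Fulton's class in `A_{k-1}(|D| ∩ |α|)`: on a component
`V ⊆ |D|` of `α` it is the Weil divisor of some Cartier divisor on `V` in the class `j^*[D]`. This
file records the statements that hold for Fulton's classes but only up to rational equivalence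
on the support for the representatives, in the language of `Motives/CyclesRatTrivialOn`
(`ratTrivialOn X Z d` = the `d`-cycles rationally equivalent to zero through subvarieties of
`Z`). All cycles `α` here have FINITE support (Fulton's cycles are finite sums; the tree's
`AlgebraicCycle` allows locally finite sums, and an infinite sum of rational equivalences is not a
rational equivalence):

* `CartierDivisor.LinEquiv.primeInter_sub_primeInter_mem` — for `D ∼ E`,
  `D · [V] - E · [V] ∈ Rat(X; V)`: the class `D · [V]` depends only on `𝒪_X(D)` (Fulton,
  Def. 2.3 / Def. 2.2.2: well defined by Lemma 2.2 and §2.1);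
* `CartierDivisor.LinEquiv.interCycle_sub_interCycle_mem` — `D · α - E · α ∈ Rat(X; |α|)`;
* `CartierDivisor.interCycle_add_sub_mem` — **Prop. 2.3 (b)**, `(D + E) · α - D · α - E · α`
  is rationally equivalent to zero through the components of `α` inside `|D| ∪ |E|` (on the
  others it vanishes identically, `primeInter_add`);
* `CartierDivisor.interCycle_zero`, `CartierDivisor.interCycle_principal_mem` — **Prop. 2.3 (e)**:
  `0 · α = 0` and `div(h) · α ∈ Rat(X; |α|)`.

Here `|α|` is rendered as the set of specialisations of the points of the support of `α`
(the union of the subvarieties `V` appearing in `α`). Groundwork for Fulton's Theorem 2.4 (step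
(∗) of the proof) and Cor. 2.4.1, toward the Gysin map of a Cartier divisor used by
Hirschowitz–Iyer, Contemp. Math. **522** (2010), §2 (`Motives/HirschowitzIyerQuadricCubic`).

## References

* W. Fulton, *Intersection Theory*, 2nd ed., Springer 1998, Def. 2.2.2, Def. 2.3, Prop. 2.3 (b),
  (e) (pp. 32–35). [Fulton1998]
-/

noncomputable section

universe u

open CategoryTheory AlgebraicGeometry Order Topology

namespace Literature.AlgebraicGeometry.Motives

/-- Push-forward of cycles commutes with subtraction. (Also in
`Motives/AlgebraicEquivalencePushforwardFacts`, not imported here.) [folklore] -/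
theorem algebraicCycleMap_sub' {X Y : Scheme.{u}} (f : X ⟶ Y) [QuasiCompact f]
    (c c' : AlgebraicCycle X ℤ) :
    AlgebraicCycle.map f height height (c - c') =
      AlgebraicCycle.map f height height c - AlgebraicCycle.map f height height c' := by
  rw [sub_eq_add_neg, algebraicCycleMap_add, algebraicCycleMap_neg, ← sub_eq_add_neg]

namespace CartierDivisor

open RatFn

variable {K : Type u} [Field K] {X : SchemeOver K} [IsIntegral X.left] [LocallyOfFiniteType X.hom]

/-! ### Finite cycles: `D · α` as a finite sum -/

/-- For a cycle with finite support, `D · α = Σ_z α(z) · (D · [closure {z}])` as a finite sum of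
cycles. [folklore] -/
theorem interCycle_eq_sum (D : CartierDivisor X.left) {c : AlgebraicCycle X.left ℤ}
    (hc : (Function.support c).Finite) :
    D.interCycle c = ∑ z ∈ hc.toFinset, c z • D.primeInter z := by
  ext x
  rw [D.interCycle_apply_eq_sum c x (s := hc.toFinset) fun z hz _ => hc.mem_toFinset.mpr hz]
  simp only [Function.locallyFinsuppWithin.coe_sum, Finset.sum_apply,
    Function.locallyFinsuppWithin.coe_zsmul, Pi.smul_apply, smul_eq_mul]

/-! ### `D · [V]` depends only on the divisor class, up to rational equivalence on `V` -/

/-- **For linearly equivalent `D ∼ E`, `D · [V] - E · [V] ∈ Rat_d(X; V)`**, `V = closure {z}` of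
dimension `d + 1`: the representatives `pullbackRep` of `j^*D`, `j^*E` are linearly equivalent on
`V`, hence have rationally equivalent Weil divisors on `V` (Fulton §2.1), pushed into `X`
(Fulton, Def. 2.3 with Def. 2.2.2: the class `D · [V]` only depends on `𝒪_X(D)`).
[cite: Fulton1998, Def. 2.3 (p. 33)] -/
theorem LinEquiv.primeInter_sub_primeInter_mem {D E : CartierDivisor X.left} (H : D.LinEquiv E)
    {z : X.left} {d : ℕ} (hz : height z = d + 1) :
    D.primeInter z - E.primeInter z ∈ ratTrivialOn X.left (closure {z}) d := by
  set V := ClosedSubvariety.ofPoint X.left z with hV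
  have hVd : height (⊤ : ↥(V.over X.hom).left) = d + 1 := by
    rw [← hz]
    exact height_top_ofPoint z
  have h := ((H.pullbackRep V.ι).symm).cycle_sub_cycle_mem_ratTrivial (V := V.over X.hom) hVd
  have h' := map_mem_ratTrivialOn_range_of_mem_ratTrivial V.ι h
  rw [ClosedSubvariety.range_ofPoint_ι] at h'
  have key : D.primeInter z - E.primeInter z = AlgebraicCycle.map V.ι height height
      ((D.pullbackRep V.ι).cycle - (E.pullbackRep V.ι).cycle) := by
    rw [algebraicCycleMap_sub']
    rfl
  rw [key]
  exact h'

omit [IsIntegral X.left] [LocallyOfFiniteType X.hom] in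
/-- The union `|α|` of the subvarieties of a cycle: the specialisations of the points of its
support. A component `closure {z}` of `α` lies in it. [folklore] -/
theorem closure_subset_setOf_specializes {c : AlgebraicCycle X.left ℤ} {z : X.left} (hz : c z ≠ 0) :
    closure {z} ⊆ {x : X.left | ∃ z, c z ≠ 0 ∧ z ⤳ x} := fun _ hx =>
  ⟨z, hz, specializes_iff_mem_closure.mpr hx⟩

/-- **For `D ∼ E` and a finite `(d+1)`-cycle `α`, `D · α - E · α ∈ Rat_d(X; |α|)`** (Fulton,
Def. 2.3: `D · α ∈ A_{k-1}(|D| ∩ |α|)` depends only on `𝒪_X(D)`). [cite: Fulton1998, Def. 2.3 (p. 33)] -/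
theorem LinEquiv.interCycle_sub_interCycle_mem {D E : CartierDivisor X.left} (H : D.LinEquiv E)
    {c : AlgebraicCycle X.left ℤ} {d : ℕ} (hcd : c ∈ cyclesOfDim X.left (d + 1))
    (hc : (Function.support c).Finite) :
    D.interCycle c - E.interCycle c ∈ ratTrivialOn X.left {x | ∃ z, c z ≠ 0 ∧ z ⤳ x} d := by
  rw [D.interCycle_eq_sum hc, E.interCycle_eq_sum hc, ← Finset.sum_sub_distrib]
  refine AddSubgroup.sum_mem _ fun z hz => ?_
  have hz' : c z ≠ 0 := hc.mem_toFinset.mp hz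
  have hzd : height z = d + 1 := by
    rw [hcd z hz']
    push_cast
    rfl
  rw [← smul_sub]
  exact AddSubgroup.zsmul_mem _
    (ratTrivialOn_mono (closure_subset_setOf_specializes hz') (H.primeInter_sub_primeInter_mem hzd)) _

/-- Presentations of the same divisor have `D · α - E · α ∈ Rat_d(X; |α|)`. [folklore] -/
theorem SameDivisor.interCycle_sub_interCycle_mem {D E : CartierDivisor X.left} (H : D.SameDivisor E)
    {c : AlgebraicCycle X.left ℤ} {d : ℕ} (hcd : c ∈ cyclesOfDim X.left (d + 1))
    (hc : (Function.support c).Finite) :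
    D.interCycle c - E.interCycle c ∈ ratTrivialOn X.left {x | ∃ z, c z ≠ 0 ∧ z ⤳ x} d :=
  H.linEquiv.interCycle_sub_interCycle_mem hcd hc

/-! ### Additivity in the divisor (Fulton, Prop. 2.3 (b)) -/

/-- `(D + E) · [V] - D · [V] - E · [V] ∈ Rat_d(X; V)` for every component `V = closure {z}` of
dimension `d + 1` (and `= 0` if `D`, `E` avoid `z`, `primeInter_add`). [cite: Fulton1998, Prop. 2.3 (b) (p. 34)] -/
theorem primeInter_add_sub_mem (D E : CartierDivisor X.left) {z : X.left} {d : ℕ} (hz : height z = d + 1) :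
    (D + E).primeInter z - (D.primeInter z + E.primeInter z) ∈ ratTrivialOn X.left (closure {z}) d := by
  set V := ClosedSubvariety.ofPoint X.left z with hV
  have hVd : height (⊤ : ↥(V.over X.hom).left) = d + 1 := by
    rw [← hz]
    exact height_top_ofPoint z
  -- `(D + E)|_V ∼ D|_V + E|_V` for the representatives
  have hlin : (D.pullbackRep V.ι + E.pullbackRep V.ι).LinEquiv ((D + E).pullbackRep V.ι) :=
    ((((D.classPullback_linEquiv_pullbackRep V.ι).symm).add
      ((E.classPullback_linEquiv_pullbackRep V.ι).symm)).trans
        (classPullback_add_linEquiv V.ι D E).symm).trans ((D + E).classPullback_linEquiv_pullbackRep V.ι)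
  have h := hlin.cycle_sub_cycle_mem_ratTrivial (V := V.over X.hom) hVd
  have h' := map_mem_ratTrivialOn_range_of_mem_ratTrivial V.ι h
  rw [ClosedSubvariety.range_ofPoint_ι] at h'
  have key : (D + E).primeInter z - (D.primeInter z + E.primeInter z) =
      AlgebraicCycle.map V.ι height height
        (((D + E).pullbackRep V.ι).cycle - (D.pullbackRep V.ι + E.pullbackRep V.ι).cycle) := by
    rw [algebraicCycleMap_sub', cycle_add, algebraicCycleMap_add]
    rfl
  rw [key]
  exact h'

/-- **Fulton, Prop. 2.3 (b): `(D + D') · α = D · α + D' · α` in `A_{k-1}((|D| ∪ |D'|) ∩ |α|)`.**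
For a finite `(d+1)`-cycle `α`, `(D + E) · α - D · α - E · α` lies in `Rat_d(X; Z)` for the union
`Z` of the components of `α` contained in `|D| ∪ |E|` (on the components off `|D| ∪ |E|` the
three cycles are additive on the nose, `primeInter_add`). [cite: Fulton1998, Prop. 2.3 (b) (p. 34)] -/
theorem interCycle_add_sub_mem (D E : CartierDivisor X.left) {c : AlgebraicCycle X.left ℤ} {d : ℕ}
    (hcd : c ∈ cyclesOfDim X.left (d + 1)) (hc : (Function.support c).Finite) :
    (D + E).interCycle c - (D.interCycle c + E.interCycle c) ∈
      ratTrivialOn X.left {x | ∃ z, c z ≠ 0 ∧ ¬ (D.Avoids z ∧ E.Avoids z) ∧ z ⤳ x} d := by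
  rw [(D + E).interCycle_eq_sum hc, D.interCycle_eq_sum hc, E.interCycle_eq_sum hc,
    ← Finset.sum_add_distrib, ← Finset.sum_sub_distrib]
  refine AddSubgroup.sum_mem _ fun z hz => ?_
  have hz' : c z ≠ 0 := hc.mem_toFinset.mp hz
  have hzd : height z = d + 1 := by
    rw [hcd z hz']
    push_cast
    rfl
  by_cases hDE : D.Avoids z ∧ E.Avoids z
  · rw [primeInter_add hDE.1 hDE.2, smul_add, sub_self]
    exact zero_mem _
  · rw [← smul_add, ← smul_sub]
    refine AddSubgroup.zsmul_mem _ (ratTrivialOn_mono (fun x hx => ?_) (primeInter_add_sub_mem D E hzd)) _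
    exact ⟨z, hz', hDE, specializes_iff_mem_closure.mpr hx⟩

/-! ### Principal divisors (Fulton, Prop. 2.3 (e)) -/

omit [LocallyOfFiniteType X.hom] in
/-- The representative of the restriction of the zero divisor is the zero divisor, up to
`SameDivisor`. [folklore] -/
theorem zero_pullbackRep_sameDivisor_zero {Y : Scheme.{u}} [IsIntegral Y] (g : Y ⟶ X.left) :
    ((0 : CartierDivisor X.left).pullbackRep g).SameDivisor 0 := by
  rw [pullbackRep_of_avoids 0 g (avoids_zero _)]
  intro i j y _ _
  rw [pullbackAvoiding_f, zero_f, zero_f, pullbackFn_one, div_one]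
  exact isUnitAt_one

/-- `0 · [V] = 0` as a cycle. [folklore] -/
@[simp]
theorem zero_primeInter (z : X.left) : (0 : CartierDivisor X.left).primeInter z = 0 := by
  rw [primeInter, (zero_pullbackRep_sameDivisor_zero _).cycle_eq]
  have h0 : (0 : CartierDivisor (ClosedSubvariety.ofPoint X.left z).carrier).cycle = 0 := by
    ext v
    change (principal 1 one_ne_zero).cycle v = 0
    rw [coe_cycle_principal]
    exact isUnitAt_one.ord_eq_zero
  rw [h0, algebraicCycleMap_zero]

/-- **`0 · α = 0`** as a cycle. [folklore] -/
@[simp]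
theorem zero_interCycle (c : AlgebraicCycle X.left ℤ) : (0 : CartierDivisor X.left).interCycle c = 0 := by
  ext x
  rw [interCycle_apply]
  simp

/-- **Fulton, Prop. 2.3 (e): `div(h) · α = 0` in `A_{k-1}(|α|)`**: for a finite `(d+1)`-cycle
`α` and `h ∈ K(X)ˣ`, the cycle `div(h) · α` lies in `Rat_d(X; |α|)` (`div(h) ∼ 0` and `0 · α = 0`).
[cite: Fulton1998, Prop. 2.3 (e) (p. 34)] -/
theorem interCycle_principal_mem {h : X.left.functionField} (hh : h ≠ 0) {c : AlgebraicCycle X.left ℤ}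
    {d : ℕ} (hcd : c ∈ cyclesOfDim X.left (d + 1)) (hc : (Function.support c).Finite) :
    (principal h hh).interCycle c ∈ ratTrivialOn X.left {x | ∃ z, c z ≠ 0 ∧ z ⤳ x} d := by
  have H := (principal_linEquiv_zero hh).interCycle_sub_interCycle_mem hcd hc
  rwa [zero_interCycle, sub_zero] at H

end CartierDivisor

end Literature.AlgebraicGeometry.Motives

end
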